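import Literature.AlgebraicGeometry.AbelianSchemes.AbelianSchemeEndomorphismTransportBaseChangeComp   -- ★ ASM (a) p847545
import Literature.AlgebraicGeometry.AbelianSchemes.AbelianSchemeHomGlueOverCover                      -- ★ ASM (b) p847468 + p847480
import HarnessLib

/-!
# Gluing a FAMILY of endomorphisms of `(A ×_M S) ×_S T` from per-leg families on `A ×_M U_q` along equal composites `h_q ≫ g ≫ f = k_q`
# ([GortzWedhorn2020] §(3.5) Prop. 3.10 (disjoint unions), §(4.7) and Prop. 4.16 (base change), §(4.15) (homomorphisms are local))

Topic `AlgebraicGeometry/AbelianSchemes`, namespace `Literature.AlgebraicGeometry.AbelianSchemes.AbelianSchemeOver`.  THEOREMS ONLY (no definition,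
no named fact, no instance, no notation, no `sorry`).  Cell `hodgecm-mathlib` (D-0151), FLOOR 0, P6 «MOD» (crux hLiu418 = stmt-HodgeConjecture-24832,
`--supports`), Σ-AN line of the E6 closer (A-p04 (g24) skeleton `SigmaAN.skeleton.v1sf` ee5c6ea0, stub **`stub_GLUE`** ∕ socket text `GluedFamily`, dealt to
LA6-p03 (g0) 03:07Z): ★ ASM (a) `exists_isMonHom_conj_baseChange_baseChange_baseChange` per `(q, b)` + ★ ASM (b) `exists_hom_of_isColimit_cofan` per `b`,
COMPOSED ONCE so that the skeleton pays `stub_GLUE` by `exact` with `(A, f, g, h, k) := (C.𝓜.univ.A, φ₂, prX, leg, φ₁)`.  HC_CM is proved only modulo the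
printed citations (2 remaining named inputs hLiu418 24832, h413 24833) until rung 0 closes; this file is generic and changes no count.

THE MATHEMATICS.  `A → M` an abelian scheme, `f : S → M`, `g : T → S`, and `(h_q : U_q → T)_q` the legs of a COLIMIT COFAN of `T` (a disjoint open cover,
[GortzWedhorn2020] Prop. 3.10 ∕ Ex. 3.11), with `k_q : U_q → M`, `h_q ≫ g ≫ f = k_q`.  For every leg the iterated base change `((A ×_M S) ×_S T) ×_T U_q` and
`A ×_M U_q` are base changes of `A` along the SAME map, hence isomorphic as `U_q`-group schemes compatibly with the projections to `A` (★ ASM (a),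
[GortzWedhorn2020] Prop. 4.16); so a family `Y₁ q b` (`b ∈ κ`) of homomorphisms `A ×_M U_q → A ×_M U_q` conjugates to homomorphisms `Y′ q b` of the leg
pieces of `(A ×_M S) ×_S T`, and for each `b` the `Y′ q b` glue (no compatibility: the legs are pairwise disjoint) to ONE homomorphism `Y b` of
`(A ×_M S) ×_S T` with `Y b ×_T U_q = Y′ q b` (★ ASM (b), [GortzWedhorn2020] §(4.15) + Prop. 3.5).  OUTPUT (the tokens of `GluedFamily`): `Y : κ → End`,
all homomorphisms, and for every `(q, b)` an `IsMonHom` isomorphism `e : ((A ×_M S) ×_S T) ×_T U_q ≅ A ×_M U_q` with `e ≫ pr_A = pr ≫ pr ≫ pr_A` and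
`(Y b)|_{U_q} ≫ e = e ≫ Y₁ q b`.

* §1 **`exists_family_glue_along_legs`** — THE HEAD (shape of `GluedFamily`); `exists_family_glue_along_legs'` — the same with the restriction
  `(Over.pullback (h q)).map (Y b)` NAMED (`= Y′ q b`, a homomorphism) and ASM (a)'s point formula kept, for readers of the glued family at points.

## References
* [GortzWedhorn2020] U. Görtz, T. Wedhorn, *Algebraic Geometry I*, 2nd ed. (2020), §(3.3) Prop. 3.5, §(3.5) Prop. 3.10 and Example 3.11 (p. 73), Section (4.7)
  (pp. 107–108), Prop. 4.16 (p. 101), §(4.15) (p. 116).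
* [MumfordFogartyKirwan1994] D. Mumford, J. Fogarty, F. Kirwan, *Geometric Invariant Theory*, 3rd ed. (1994), Ch. 6 §1 Definition 6.1 (p. 115), Ch. 7 §2
  Definition 7.3 (p. 130).
-/

set_option autoImplicit false

noncomputable section

universe u v

open CategoryTheory CategoryTheory.Limits AlgebraicGeometry
open scoped MonObj

namespace Literature.AlgebraicGeometry.AbelianSchemes

namespace AbelianSchemeOver

variable {M S T : Scheme.{u}} (A : AbelianSchemeOver M) (f : S ⟶ M) (g : T ⟶ S)
  {σ : Type u} {U : σ → Scheme.{u}} (h : ∀ q, U q ⟶ T) (hc : IsColimit (Cofan.mk T h))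
  (k : ∀ q, U q ⟶ M) (hk : ∀ q, h q ≫ g ≫ f = k q)
  {κ : Type v} (Y₁ : ∀ q, κ → ((A.baseChange (k q)).X ⟶ (A.baseChange (k q)).X)) (hY₁ : ∀ q b, IsMonHom (Y₁ q b))

include hc hk hY₁

/-- **GLUED ENDOMORPHISM FAMILY ALONG THE LEGS, with the leg endomorphisms named**: for per-leg families `Y₁ q b` of homomorphisms of `A ×_M U_q` there
are homomorphisms `Y b` of `(A ×_M S) ×_S T` (`b ∈ κ`) and, for every `(q, b)`, the ★ ASM (a) data `(e, Y′)` — `e : ((A ×_M S) ×_S T) ×_T U_q ≅ A ×_M U_q` an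
`IsMonHom` iso with `e ≫ pr_A = pr ≫ pr ≫ pr_A`, `Y′` a homomorphism with `Y′ ≫ e = e ≫ Y₁ q b` and the point formula — such that `(Y b)|_{U_q} = Y′`
(★ ASM (b) glue over the cofan, per `b`). [cite: GortzWedhorn2020, §(3.5) Proposition 3.10 (p. 73); Section (4.7) (pp. 107–108); Prop. 4.16 (p. 101); §(4.15) (p. 116)] -/
theorem exists_family_glue_along_legs' :
    ∃ (Y : κ → (((A.baseChange f).baseChange g).X ⟶ ((A.baseChange f).baseChange g).X)) (_ : ∀ b, IsMonHom (Y b)),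
      ∀ (q : σ) (b : κ),
        ∃ (e : (((A.baseChange f).baseChange g).baseChange (h q)).X ≅ (A.baseChange (k q)).X)
          (Y' : (((A.baseChange f).baseChange g).baseChange (h q)).X ⟶ (((A.baseChange f).baseChange g).baseChange (h q)).X),
          IsMonHom e.hom ∧ IsMonHom Y' ∧
          e.hom.left ≫ pullback.fst A.X.hom (k q) =
            pullback.fst (pullback.snd (pullback.snd A.X.hom f) g) (h q) ≫ pullback.fst (pullback.snd A.X.hom f) g ≫ pullback.fst A.X.hom f ∧
          Y' ≫ e.hom = e.hom ≫ Y₁ q b ∧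
          Y'.left ≫ (pullback.fst (pullback.snd (pullback.snd A.X.hom f) g) (h q) ≫ pullback.fst (pullback.snd A.X.hom f) g ≫
              pullback.fst A.X.hom f) = e.hom.left ≫ (Y₁ q b).left ≫ pullback.fst A.X.hom (k q) ∧
          (Over.pullback (h q)).map (Y b) = Y' := by
  -- ★ ASM (a) per `(b, q)`: the leg iso `e` and the conjugate endomorphism `Y′`
  have hA : ∀ (b : κ) (q : σ),
      ∃ (e : (((A.baseChange f).baseChange g).baseChange (h q)).X ≅ (A.baseChange (k q)).X)
        (Y' : (((A.baseChange f).baseChange g).baseChange (h q)).X ⟶ (((A.baseChange f).baseChange g).baseChange (h q)).X),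
        IsMonHom e.hom ∧ IsMonHom Y' ∧
        e.hom.left ≫ pullback.fst A.X.hom (k q) =
          pullback.fst (pullback.snd (pullback.snd A.X.hom f) g) (h q) ≫ pullback.fst (pullback.snd A.X.hom f) g ≫ pullback.fst A.X.hom f ∧
        Y' ≫ e.hom = e.hom ≫ Y₁ q b ∧
        Y'.left ≫ (pullback.fst (pullback.snd (pullback.snd A.X.hom f) g) (h q) ≫ pullback.fst (pullback.snd A.X.hom f) g ≫
            pullback.fst A.X.hom f) = e.hom.left ≫ (Y₁ q b).left ≫ pullback.fst A.X.hom (k q) := fun b q => by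
    haveI := hY₁ q b
    exact exists_isMonHom_conj_baseChange_baseChange_baseChange A f g (h q) (k q) (hk q) (Y₁ q b)
  choose e Y' he hY' hfst hcomm hpt using hA
  -- ★ ASM (b) per `b`: glue the `Y′ b q` over the cofan of legs
  have hB : ∀ b : κ, ∃ Yb : ((A.baseChange f).baseChange g).X ⟶ ((A.baseChange f).baseChange g).X,
      IsMonHom Yb ∧ ∀ q, (Over.pullback (h q)).map Yb = Y' b q := fun b =>
    exists_hom_of_isColimit_cofan ((A.baseChange f).baseChange g) ((A.baseChange f).baseChange g) hc (Y' b) (hY := hY' b)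
  choose Y hY hres using hB
  exact ⟨Y, hY, fun q b => ⟨e b q, Y' b q, he b q, hY' b q, hfst b q, hcomm b q, hpt b q, hres b q⟩⟩

/-- **GLUED ENDOMORPHISM FAMILY ALONG THE LEGS (THE HEAD; the tokens of the Σ-AN socket `GluedFamily`)**: for per-leg families `Y₁ q b` of homomorphisms of
`A ×_M U_q` (`h_q ≫ g ≫ f = k_q`, `(h_q)_q` a colimit cofan of `T`) there is ONE family `Y b` of homomorphisms of `(A ×_M S) ×_S T` whose restriction to every
leg is conjugate to `Y₁ q b` along an `IsMonHom` isomorphism `e : ((A ×_M S) ×_S T) ×_T U_q ≅ A ×_M U_q` over `A`: `(Y b)|_{U_q} ≫ e = e ≫ Y₁ q b`.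
[cite: GortzWedhorn2020, §(3.5) Proposition 3.10 (p. 73); Section (4.7) (pp. 107–108); Prop. 4.16 (p. 101); §(4.15) (p. 116)]
[cite: MumfordFogartyKirwan1994, Ch. 6 §1 Definition 6.1 (p. 115)] -/
theorem exists_family_glue_along_legs :
    ∃ (Y : κ → (((A.baseChange f).baseChange g).X ⟶ ((A.baseChange f).baseChange g).X)) (_ : ∀ b, IsMonHom (Y b)),
      ∀ (q : σ) (b : κ),
        ∃ e : (((A.baseChange f).baseChange g).baseChange (h q)).X ≅ (A.baseChange (k q)).X,
          IsMonHom e.hom ∧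
          e.hom.left ≫ pullback.fst A.X.hom (k q) =
            pullback.fst (pullback.snd (pullback.snd A.X.hom f) g) (h q) ≫ pullback.fst (pullback.snd A.X.hom f) g ≫ pullback.fst A.X.hom f ∧
          (Over.pullback (h q)).map (Y b) ≫ e.hom = e.hom ≫ Y₁ q b := by
  obtain ⟨Y, hY, hleg⟩ := exists_family_glue_along_legs' A f g h hc k hk Y₁ hY₁
  refine ⟨Y, hY, fun q b => ?_⟩
  obtain ⟨e, Y', he, -, hfst, hcomm, -, hres⟩ := hleg q b
  exact ⟨e, he, hfst, by rw [hres]; exact hcomm⟩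

end AbelianSchemeOver

end Literature.AlgebraicGeometry.AbelianSchemes

end
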